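import Summits.BirchSwinnertonDyer.Rank1Residual.X4.KuriharaLevelLoweringFibres
import HarnessLib

/-!
# Level lowering kills Kurihara numbers mod `p`, part 2/3: the sums `Φ_T^{(m)}`, the DESCENT IDENTITY, and the vanishing of the Kurihara sum of an `ℓ`-old difference (cell `b2b-bsdres`, seat additive-p4, line V39)

HONEST FRAMING (verbatim, cell `b2b-bsdres`): the goal of the cell is to DELETE the COMBINATION-SHAPED
residual classes for ALL analytic-rank `≤ 1` curves over `ℚ` — "full BSD formula for every rank `≤ 1`
curve in class `C`" assembled STRICTLY from published theorems — so that the rank-`≤ 1` remainder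
becomes exactly the CONSTRUCTION-SHAPED classes, which are TYPED (missing-input Props), NOT attempted;
this is not "finishing BSD". This file: a research-route KERNEL LEMMA file (pure algebra; no named fact,
no conjecture, nothing booked; X4 stays CONSTRUCTION-SHAPED).

## What is proved (the mathematics)

Let `R` be a commutative ring, `μ : ℚ → R` a `1`-periodic function which satisfies the weight-`2`
HECKE RELATION with eigenvalue `2` at every prime `q` of a set `P`:
`∑_{j mod q} μ((r + j)/q) + μ(q r) = 2 μ(r)` (the `T_q`-relation of `r ↦ {∞ → r}` of a modular symbol,
MTT 1986 §I.4 (4.2), at a prime with `a_q ≡ q + 1 ≡ 2`, i.e. a KOLYVAGIN prime for `T/pT`). Let `n`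
be a square-free product of primes of `P`, `ψ_q : (ℤ/q)ˣ → R` additive characters, `ℓ` prime to `n`.
Then the Kurihara-type sum of the `ℓ`-OLD DIFFERENCE `λ(r) := μ(r) − μ(ℓ r)` VANISHES:
`∑_{a ∈ (ℤ/n)ˣ} λ(a/n) · ∏_{q ∣ n} ψ_q(a) = 0` (`kuriharaSum_oldform_eq_zero`).

PROOF (new as a statement; elementary). `Φ_T^{(m)} := ∑_{a ∈ (ℤ/m)ˣ} μ(a/m) ∏_{q ∈ T} ψ_q(a)` for
`m ∣ n`, `T` a set of primes of `m`. (i) DESCENT (`Phi_mul_eq`): for a prime `q ∣ qm` outside `T`, the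
unit fibre sum of part 1 gives `Φ_T^{(qm)} = ∑_b W_T(b)·[2μ(b) − μ(qb) − μ(q⁻¹b)]`; re-indexing
`b ↦ q^{∓1}b` and expanding `W_T` binomially, the two `T' = T` terms cancel `2Φ_T^{(m)}` EXACTLY,
leaving a combination of `Φ_{T'}^{(m)}`, `T' ⊊ T`. (ii) Induction on `#T` (`Phi_eq_zero_of_ssubset`):
`Φ_T^{(m)} = 0` whenever `T ⊊ primes(m)`. (iii) The same expansion of `∑_a μ(ℓa/n)W(a)` gives
`Φ_P^{(n)} +` (terms with `T' ⊊ P`), so the old difference kills the leading term and (ii) the rest.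
In Mazur–Tate language: `θ_n(λ) = (1 − σ_ℓ^{-1}) θ_n(μ)`, and `1 − σ_ℓ^{-1}` pushes the modular element
one step deeper into the augmentation filtration, past the coefficient `δ_n` of `∏(σ_{η_q} − 1)`
(Kurihara 2014 §1.1 (1)–(2); Kim–Kim–Sun, Selecta Math. 26 (2020), Thm. 7.5 and Rem. 2.3).

## References

* B. Mazur, J. Tate, J. Teitelbaum, Invent. Math. 84 (1986), §I.4 (4.2). [cite: MazurTateTeitelbaum1986Invent, §I.4 (4.2)]
* M. Kurihara, Contrib. Math. Comput. Sci. 7 (2014) 317–356, §1.1 (1)–(2). [cite: Kurihara2014, §1.1]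
* C.-H. Kim, M. Kim, H.-S. Sun, Selecta Math. 26 (2020), Rem. 2.3, Thm. 7.5. [cite: KimKimSun2020Selecta, Rem. 2.3 and Thm. 7.5]
-/

noncomputable section

open scoped MatrixGroups ModularForm

open CongruenceSubgroup Finset

open Literature.NumberTheory.EllipticCurves Literature.NumberTheory.EllipticCurves.ModularForms

namespace Summit.BirchSwinnertonDyer.Rank1Residual.LevelLowering

variable {R : Type*}

/-! ### §4 The sums `Φ_T^{(m)}` and the descent identity -/

section Descent

variable [CommRing R] {μ : ℚ → R} (ψ : (ℓ : ℕ) → (ZMod ℓ)ˣ →* Multiplicative R)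

/-- `Φ_T^{(m)} = ∑_{a ∈ (ℤ/m)ˣ} μ(a/m) · ∏_{q ∈ T} ψ_q(a)`; for `T` = the prime factors of `m` this is the
Kurihara sum of `μ` at `m`. [cite: Kurihara2014, §1.1] -/
def Phi (μ : ℚ → R) (m : ℕ) [NeZero m] (T : Finset ℕ) : R :=
  ∑ a : (ZMod m)ˣ, lev μ m (a : ZMod m) * weight ψ m T a

/-- **Twisting by a unit**: `∑_b μ(ub/m) W_T(b) = ∑_{T' ⊆ T} (∏_{q ∈ T∖T'} ψ_q(u⁻¹)) Φ_{T'}^{(m)}`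
(re-index `b ↦ u⁻¹b` and expand the weight binomially). [folklore] -/
theorem sum_lev_unit_mul_weight (m : ℕ) [NeZero m] {T : Finset ℕ}
    (hT : ∀ q ∈ T, q ∣ m) (u : (ZMod m)ˣ) :
    ∑ b : (ZMod m)ˣ, lev μ m ((u * b : (ZMod m)ˣ) : ZMod m) * weight ψ m T b =
      ∑ T' ∈ T.powerset, (∏ q ∈ T \ T', chi ψ m q u⁻¹) * Phi ψ μ m T' := by
  have hre : ∑ b : (ZMod m)ˣ, lev μ m ((u * b : (ZMod m)ˣ) : ZMod m) * weight ψ m T b =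
      ∑ b : (ZMod m)ˣ, lev μ m (b : ZMod m) * weight ψ m T (u⁻¹ * b) := by
    refine Fintype.sum_equiv (Equiv.mulLeft u) _ _ fun b ↦ ?_
    simp only [Equiv.coe_mulLeft, inv_mul_cancel_left]
  rw [hre]
  simp_rw [weight_mul ψ hT u⁻¹, Finset.mul_sum]
  rw [Finset.sum_comm]
  refine Finset.sum_congr rfl fun T' _ ↦ ?_
  rw [Phi, Finset.mul_sum]
  exact Finset.sum_congr rfl fun b _ ↦ by ring

/-- **THE DESCENT IDENTITY.** For `q` prime, `q ∤ m`, `μ` periodic with the Hecke relation at `q`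
(eigenvalue `2`) and `T` a set of divisors of `m`:
`Φ_T^{(qm)} = −∑_{T' ⊊ T} (∏_{T∖T'} ψ_i(q⁻¹) + ∏_{T∖T'} ψ_i(q)) · Φ_{T'}^{(m)}` — the two `T' = T`
terms of the binomial expansions cancel the fibre's `2·Φ_T^{(m)}` EXACTLY.
[cite: MazurTateTeitelbaum1986Invent, §I.4 (4.2)] -/
theorem Phi_mul_eq (hμ : IsPeriodic μ) (m q : ℕ) [NeZero m] [NeZero (q * m)] (hq : q.Prime)
    (hmq : m.Coprime q) (hH : HeckeRel μ q 2) {T : Finset ℕ} (hT : ∀ i ∈ T, i ∣ m) :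
    Phi ψ μ (q * m) T = -∑ T' ∈ T.powerset.erase T,
      ((∏ i ∈ T \ T', chi ψ m i (ZMod.unitOfCoprime q hmq.symm)⁻¹) +
        ∏ i ∈ T \ T', chi ψ m i (ZMod.unitOfCoprime q hmq.symm)) * Phi ψ μ m T' := by
  set uq : (ZMod m)ˣ := ZMod.unitOfCoprime q hmq.symm with huq
  have huqval : (uq : ZMod m) = q := ZMod.coe_unitOfCoprime q hmq.symm
  -- Step 1: fibre by fibre
  have step1 : Phi ψ μ (q * m) T = ∑ b : (ZMod m)ˣ, weight ψ m T b *
      (2 * lev μ m b - lev μ m ((uq * b : (ZMod m)ˣ) : ZMod m) -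
        lev μ m ((uq⁻¹ * b : (ZMod m)ˣ) : ZMod m)) := by
    unfold Phi
    have hw : ∀ v : (ZMod (q * m))ˣ,
        weight ψ (q * m) T v = weight ψ m T (ZMod.unitsMap (dvd_mul_left m q) v) :=
      fun v ↦ (weight_unitsMap ψ (dvd_mul_left m q) hT v).symm
    simp_rw [hw]
    rw [← Finset.sum_fiberwise Finset.univ
      (fun v : (ZMod (q * m))ˣ ↦ ZMod.unitsMap (dvd_mul_left m q) v)
      (fun v ↦ lev μ (q * m) (v : ZMod (q * m)) *
        weight ψ m T (ZMod.unitsMap (dvd_mul_left m q) v))]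
    refine Finset.sum_congr rfl fun b _ ↦ ?_
    have hinner : ∑ v ∈ Finset.univ.filter
        (fun v : (ZMod (q * m))ˣ ↦ ZMod.unitsMap (dvd_mul_left m q) v = b),
        lev μ (q * m) (v : ZMod (q * m)) * weight ψ m T (ZMod.unitsMap (dvd_mul_left m q) v) =
        (∑ v ∈ Finset.univ.filter
          (fun v : (ZMod (q * m))ˣ ↦ ZMod.unitsMap (dvd_mul_left m q) v = b),
          lev μ (q * m) (v : ZMod (q * m))) * weight ψ m T b := by
      rw [Finset.sum_mul]
      refine Finset.sum_congr rfl fun v hv ↦ ?_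
      rw [(Finset.mem_filter.mp hv).2]
    rw [hinner, sum_units_fibre_lev hμ m q hq hmq hH b, ← huq, mul_comm _ (weight ψ m T b),
      ← huqval, ← Units.val_mul, mul_comm b uq⁻¹]
  -- Step 2: the two twisted sums
  have hS : ∀ u : (ZMod m)ˣ, ∑ b : (ZMod m)ˣ, weight ψ m T b * lev μ m ((u * b : (ZMod m)ˣ) : ZMod m) =
      Phi ψ μ m T + ∑ T' ∈ T.powerset.erase T, (∏ i ∈ T \ T', chi ψ m i u⁻¹) * Phi ψ μ m T' := by
    intro u
    have h := sum_lev_unit_mul_weight (μ := μ) ψ m hT u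
    rw [← Finset.add_sum_erase _ _ (Finset.mem_powerset_self T), Finset.sdiff_self,
      Finset.prod_empty, one_mul] at h
    rw [← h]
    exact Finset.sum_congr rfl fun b _ ↦ mul_comm _ _
  have hS1 := hS uq
  have hS2 := hS uq⁻¹
  rw [inv_inv] at hS2
  -- Step 3: algebra
  rw [step1]
  have hsplit : ∑ b : (ZMod m)ˣ, weight ψ m T b *
      (2 * lev μ m b - lev μ m ((uq * b : (ZMod m)ˣ) : ZMod m) -
        lev μ m ((uq⁻¹ * b : (ZMod m)ˣ) : ZMod m)) =
      2 * Phi ψ μ m T - ∑ b : (ZMod m)ˣ, weight ψ m T b * lev μ m ((uq * b : (ZMod m)ˣ) : ZMod m) -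
        ∑ b : (ZMod m)ˣ, weight ψ m T b * lev μ m ((uq⁻¹ * b : (ZMod m)ˣ) : ZMod m) := by
    simp only [mul_sub, Finset.sum_sub_distrib, Phi, Finset.mul_sum]
    congr 2
    exact Finset.sum_congr rfl fun b _ ↦ by ring
  rw [hsplit, hS1, hS2]
  have hcomb : ∑ T' ∈ T.powerset.erase T,
      ((∏ i ∈ T \ T', chi ψ m i uq⁻¹) + ∏ i ∈ T \ T', chi ψ m i uq) * Phi ψ μ m T' =
      ∑ T' ∈ T.powerset.erase T, (∏ i ∈ T \ T', chi ψ m i uq⁻¹) * Phi ψ μ m T' +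
        ∑ T' ∈ T.powerset.erase T, (∏ i ∈ T \ T', chi ψ m i uq) * Phi ψ μ m T' := by
    rw [← Finset.sum_add_distrib]
    exact Finset.sum_congr rfl fun _ _ ↦ add_mul _ _ _
  rw [hcomb]
  ring

/-- **`Φ_T^{(n)} = 0` for every PROPER subset `T` of the primes of `n`** (`n` square-free, each prime
of `n` a Hecke prime of eigenvalue `2` for `μ`), by induction on `#T` along the descent identity.
[folklore] -/
theorem Phi_eq_zero_of_ssubset (hμ : IsPeriodic μ) {P : ℕ → Prop}
    (hP : ∀ q, P q → q.Prime ∧ HeckeRel μ q 2) :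
    ∀ (k : ℕ) (n : ℕ) [NeZero n] (T : Finset ℕ), Squarefree n → (∀ q ∈ n.primeFactors, P q) →
      T ⊂ n.primeFactors → T.card = k → Phi ψ μ n T = 0 := by
  intro k
  induction k using Nat.strong_induction_on with
  | _ k ih =>
  intro n _ T hn hPn hT hk
  obtain ⟨q, hqn, hqT⟩ := Finset.exists_of_ssubset hT
  have hqprime : q.Prime := Nat.prime_of_mem_primeFactors hqn
  obtain ⟨m, rfl⟩ := Nat.dvd_of_mem_primeFactors hqn
  have hm0 : m ≠ 0 := fun h ↦ NeZero.ne (q * m) (by rw [h, mul_zero])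
  haveI : NeZero m := ⟨hm0⟩
  obtain ⟨hcop, -, hsqm⟩ := Nat.squarefree_mul_iff.mp hn
  have hTsub : T ⊆ (q * m).primeFactors := (Finset.ssubset_iff_subset_ne.mp hT).1
  have hTm : ∀ i ∈ T, i ∣ m := by
    intro i hi
    have hi' := hTsub hi
    have hip : i.Prime := Nat.prime_of_mem_primeFactors hi'
    have hidvd : i ∣ q * m := Nat.dvd_of_mem_primeFactors hi'
    rcases (Nat.Prime.dvd_mul hip).mp hidvd with h | h
    · exact absurd ((Nat.prime_dvd_prime_iff_eq hip hqprime).mp h ▸ hi) hqT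
    · exact h
  rw [Phi_mul_eq ψ hμ m q hqprime hcop.symm (hP q (hPn q hqn)).2 hTm]
  rw [Finset.sum_eq_zero, neg_zero]
  intro T' hT'
  obtain ⟨hne, hsub⟩ := Finset.mem_erase.mp hT'
  have hsub' : T' ⊆ T := Finset.mem_powerset.mp hsub
  have hss : T' ⊂ T := Finset.ssubset_iff_subset_ne.mpr ⟨hsub', hne⟩
  have hTm' : T ⊆ m.primeFactors := fun i hi ↦
    Nat.mem_primeFactors.mpr ⟨Nat.prime_of_mem_primeFactors (hTsub hi), hTm i hi, hm0⟩
  have hPm : ∀ q' ∈ m.primeFactors, P q' := fun q' hq' ↦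
    hPn q' (Nat.primeFactors_mono (dvd_mul_left m q) (NeZero.ne (q * m)) hq')
  rw [ih T'.card (hk ▸ Finset.card_lt_card hss) m T' hsqm hPm (lt_of_lt_of_le hss hTm') rfl,
    mul_zero]

/-- **MAIN THEOREM (level lowering kills Kurihara sums).** `μ : ℚ → R` periodic with the Hecke
relation (eigenvalue `2`) at every prime of the square-free `n`; `ℓ` prime to `n`. Then the Kurihara
sum of the `ℓ`-old difference `λ(r) = μ(r) − μ(ℓ r)` at `n` vanishes:
`∑_{a ∈ (ℤ/n)ˣ} (μ(a/n) − μ(ℓa/n)) · ∏_{q ∣ n} ψ_q(a) = 0`.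
[cite: Kurihara2014, §1.1 (1)–(2)] [cite: MazurTateTeitelbaum1986Invent, §I.4 (4.2)] -/
theorem kuriharaSum_oldform_eq_zero (hμ : IsPeriodic μ) {P : ℕ → Prop}
    (hP : ∀ q, P q → q.Prime ∧ HeckeRel μ q 2) (n : ℕ) [NeZero n] (hn : Squarefree n)
    (hPn : ∀ q ∈ n.primeFactors, P q) {ℓ : ℕ} (hℓ : ℓ.Coprime n) :
    ∑ a : (ZMod n)ˣ, (μ ((((a : ZMod n).val : ℕ) : ℚ) / n) -
        μ ((ℓ : ℚ) * ((((a : ZMod n).val : ℕ) : ℚ) / n))) * weight ψ n n.primeFactors a = 0 := by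
  set u : (ZMod n)ˣ := ZMod.unitOfCoprime ℓ hℓ with hu
  have h1 : ∀ a : (ZMod n)ˣ, μ ((ℓ : ℚ) * ((((a : ZMod n).val : ℕ) : ℚ) / n)) =
      lev μ n ((u * a : (ZMod n)ˣ) : ZMod n) := by
    intro a
    rw [Units.val_mul, hu, ZMod.coe_unitOfCoprime, lev_natCast_mul hμ, mul_div_assoc]
  have h0 : ∀ a : (ZMod n)ˣ, μ ((((a : ZMod n).val : ℕ) : ℚ) / n) = lev μ n (a : ZMod n) :=
    fun a ↦ rfl
  simp_rw [sub_mul, Finset.sum_sub_distrib, h0, h1]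
  rw [sum_lev_unit_mul_weight (μ := μ) ψ n (fun q hq ↦ Nat.dvd_of_mem_primeFactors hq) u,
    ← Finset.add_sum_erase _ _ (Finset.mem_powerset_self _), Finset.sdiff_self, Finset.prod_empty,
    one_mul]
  have hzero : ∀ T' ∈ n.primeFactors.powerset.erase n.primeFactors, Phi ψ μ n T' = 0 := by
    intro T' hT'
    obtain ⟨hne, hsub⟩ := Finset.mem_erase.mp hT'
    exact Phi_eq_zero_of_ssubset ψ hμ hP _ n T' hn hPn
      (Finset.ssubset_iff_subset_ne.mpr ⟨Finset.mem_powerset.mp hsub, hne⟩) rfl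
  rw [Finset.sum_eq_zero (s := n.primeFactors.powerset.erase n.primeFactors)
    (fun T' hT' ↦ by rw [hzero T' hT', mul_zero]), add_zero]
  exact sub_self _

end Descent


end Summit.BirchSwinnertonDyer.Rank1Residual.LevelLowering

end
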